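import Literature.Topology.FourManifolds.HandlebodyClassification
import Literature.Topology.FourManifolds.SPC4HandlesSymmHolds
import HarnessLib

/-!
# Classification of orientable `1`-handlebodies in dimension `≥ 3`, reduced to the `0`-handle
# and the `1`-handle; UNIQ₄ from L0 and L1

Topic `Literature/Topology/FourManifolds`; fact seat
`provefact-Literature.Topology.FourManifolds.exists_diffeomorph_comp_incl_eq` (Laudenbach–Poénaru
(1972): every self-diffeomorphism of `∂V ≅ #k S¹ × S²` extends over the compact connected
orientable `4`-dimensional `1`-handlebody `V ≅ ♮k S¹ × B³`; `SPC4Handles.lean` (c)).  By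
`SPC4HandlesModelReduction.lean` and `SPC4HandlesSymmHolds.lean` that fact rests on NORM, on the
three model facts, and on the **classification of orientable `4`-dimensional `1`-handlebodies**

* **UNIQ₄** `Literature.Topology.FourManifolds.nonempty_diffeomorph_of_hasHandleDecomposition_handleCount_one`
  — two compact connected orientable smooth `4`-manifolds with boundary with handle
  decompositions with one `0`-handle and `k` `1`-handles are diffeomorphic (Kosinski,
  *Differential Manifolds* (1993), VI (11.4)(c): for `(m, 1)`-handlebodies, `m > 2`, "genus and
  orientability form a complete set of diffeomorphism invariants").

One dimension lower the same statement is UNIQ of the Lickorish–Wallace programme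
(`Literature.Topology.FourManifolds.IsHandlebody.nonempty_diffeomorph`), which
`HandlebodyClassification.lean` **proves** from the two handle-theoretic inputs of Kosinski's
argument, both stated there in every dimension `n + 1`:

* **L0** `Literature.Topology.FourManifolds.zeroHandle_nonempty_diffeomorph_closedBall` — a
  `0`-handle is a disc (Milnor 1963, Thm. 3.1 and Remark p. 13; Kosinski VII (2.2), VI §6);
* **L1** `Literature.Topology.FourManifolds.oneHandle_nonempty_diffeomorph` — uniqueness of
  attaching one `1`-handle orientably to a connected boundary, `n + 1 ≥ 3` (Kosinski VI (6.6),
  proof of VI (11.4)(c), VII (2.2), III (3.6)–(3.7)).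

This file runs the same induction (Kosinski's proof of VI (11.4)(c), one handle at a time) in
every dimension `n + 1 ≥ 3` and **proves UNIQ₄ from L0 and L1**, so that the Laudenbach–Poénaru
fact and the Lickorish–Wallace theorem now share their classification leaves:

* `Literature.Topology.FourManifolds.OneHandlebodyStage n` — the induction vehicle in dimension
  `n + 1`: a compact connected orientable smooth `(n+1)`-manifold with boundary with a Morse
  function adapted to the boundary, injective on its critical set, with one critical point of
  index `0` and all critical points of index `≤ 1`; `genus` = number of index-`1` points.
* `OneHandlebodyStage.exists_cut` — cutting below the top critical point (Milnor 1965, Lemma 2.9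
  and proof of Cor. 2.10; `Literature.Topology.FourManifolds.exists_isManifold_sublevel_of_le`):
  a stage of genus `j + 1` is a stage of genus `j` with one `1`-handle attached
  (`IsHandleAttachment n 1`), `n ≥ 1`.
* `OneHandlebodyStage.isConnected_boundary` (`n ≥ 2`: coindex `≥ 2`,
  `IsMorseAdapted.isPreconnected_boundary_and_nonempty`, Kosinski VI (11.5)).
* `OneHandlebodyStage.nonempty_diffeomorph` — stages of the same genus are diffeomorphic,
  granted L0 and L1 (`n ≥ 2`).
* `exists_oneHandlebodyStage_of_hasHandleDecomposition` — a compact connected orientable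
  `(n+1)`-manifold with a handle decomposition of type `(1, k)`
  (`HasHandleDecomposition n V (handleCount 1 k)`) carries a stage of genus `k` (Milnor 1965,
  Lemma 2.8: `Literature.Topology.FourManifolds.exists_isMorseAdapted_injOn_criticalSet`).
* `nonempty_diffeomorph_of_hasHandleDecomposition_handleCount_one_of_handles'` — the
  classification in every dimension `n + 1 ≥ 3`, from L0 and L1; and its instance
  **`nonempty_diffeomorph_of_hasHandleDecomposition_handleCount_one_of_handles : L0 → L1 → UNIQ₄`**.
* `exists_diffeomorph_comp_incl_eq_of_handles` — the Laudenbach–Poénaru fact from NORM, L0, L1,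
  LEMMA2ᴹ and THMAᴹ (`exists_diffeomorph_comp_incl_eq_of_model'`, SYMMᴹ being discharged).

## References

* A. A. Kosinski, *Differential Manifolds*, Academic Press (1993): III (3.6)–(3.7); VI §6,
  (6.6), §11, (11.4)(c), (11.5); VII §2, (2.1)–(2.2). [Kosinski1993]
* J. Milnor, *Morse theory*, Ann. of Math. Studies 51 (1963), Lemma 2.2, Thms 3.1–3.2.
  [Milnor1963]
* J. Milnor, *Lectures on the h-cobordism theorem* (1965), Lemmas 2.8–2.9, Cor. 2.10, Thm. 3.13.
  [MilnorHCobordism1965]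
* A. Juhász, *Differential and Low-Dimensional Topology* (2023), §6.1. [Juhasz2023]
* F. Laudenbach, V. Poénaru, *A note on 4-dimensional handlebodies*, Bull. Soc. Math. France
  100 (1972), 337–344, §2. [LaudenbachPoenaruBSMF1972]
-/

open scoped Manifold ContDiff Topology
open Set Function Filter

noncomputable section

namespace Literature.Topology.FourManifolds

universe u

attribute [local instance] fact_finrank_euclideanSpace_succ

/-! ### Stages in dimension `n + 1` -/

/-- A **`1`-handlebody stage in dimension `n + 1`**: a compact connected orientable smooth
`(n+1)`-manifold with boundary (Hausdorff, second countable) with a Morse function adapted to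
the boundary which is injective on its critical set, has exactly one critical point of index `0`
and all critical points of index `≤ 1` — an orientable `(n+1, 1)`-handlebody of genus `g`
(Kosinski VI §11) presented by a Morse function with separated critical values (Milnor 1965,
Lemma 2.8), `g` being the number of critical points of index `1` (`OneHandlebodyStage.genus`).
Proof-internal bookkeeping for the induction `OneHandlebodyStage.nonempty_diffeomorph`; the case
`n = 2` is `Literature.Topology.FourManifolds.HandlebodyStage`.
[cite: MilnorHCobordism1965, Lemmas 2.8–2.9] [cite: Kosinski1993, VI §11] -/
structure OneHandlebodyStage (n : ℕ) : Type (u + 1) where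
  /-- The carrier. -/
  X : Type u
  /-- Its topology. -/
  [top : TopologicalSpace X]
  /-- It is Hausdorff. -/
  [t2 : T2Space X]
  /-- It is second countable. -/
  [sc : SecondCountableTopology X]
  /-- It is compact. -/
  [cpt : CompactSpace X]
  /-- It is connected. -/
  [conn : ConnectedSpace X]
  /-- Its charts (an `(n+1)`-manifold with boundary). -/
  [cs : ChartedSpace (EuclideanHalfSpace (n + 1)) X]
  /-- It is a smooth manifold with boundary. -/
  [mfd : IsManifold (𝓡∂ (n + 1)) ∞ X]
  /-- It is orientable. -/
  orientable : IsOrientable (𝓡∂ (n + 1)) X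
  /-- The presenting Morse function. -/
  f : X → ℝ
  /-- It is a Morse function adapted to the boundary. -/
  adapted : IsMorseAdapted (𝓡∂ (n + 1)) f
  /-- Its critical values are pairwise distinct. -/
  injOn_criticalSet : InjOn f (criticalSet (𝓡∂ (n + 1)) f)
  /-- It has exactly one critical point of index `0`. -/
  ncard_zero : (criticalSetOfIndex (𝓡∂ (n + 1)) f 0).ncard = 1
  /-- All critical points have index `≤ 1`. -/
  morseIndex_le_one : ∀ z, IsMCriticalPt (𝓡∂ (n + 1)) f z → morseIndex (𝓡∂ (n + 1)) f z ≤ 1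

attribute [local instance] OneHandlebodyStage.top OneHandlebodyStage.t2 OneHandlebodyStage.sc
  OneHandlebodyStage.cpt OneHandlebodyStage.conn OneHandlebodyStage.cs OneHandlebodyStage.mfd

namespace OneHandlebodyStage

variable {n : ℕ}

/-- The **genus** of a stage: the number of critical points of index `1`. [folklore] -/
def genus (s : OneHandlebodyStage.{u} n) : ℕ := (criticalSetOfIndex (𝓡∂ (n + 1)) s.f 1).ncard

/-- The critical set of a stage is finite (compactness, `IsMorse.finite_criticalSet_holds`).
[folklore] -/
theorem finite_criticalSet (s : OneHandlebodyStage.{u} n) :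
    (criticalSet (𝓡∂ (n + 1)) s.f).Finite :=
  IsMorse.finite_criticalSet_holds s.adapted.isMorse

/-- The critical points of index `k` of a stage form a finite set. [folklore] -/
theorem finite_criticalSetOfIndex (s : OneHandlebodyStage.{u} n) (k : ℕ) :
    (criticalSetOfIndex (𝓡∂ (n + 1)) s.f k).Finite :=
  s.finite_criticalSet.subset (criticalSetOfIndex_subset _ _ _)

/-- A stage has no critical points of index `≥ 2`. [folklore] -/
theorem criticalSetOfIndex_eq_empty (s : OneHandlebodyStage.{u} n) {k : ℕ} (hk : 2 ≤ k) :
    criticalSetOfIndex (𝓡∂ (n + 1)) s.f k = ∅ :=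
  eq_empty_of_forall_notMem fun z hz => by
    have := s.morseIndex_le_one z hz.1
    rw [hz.2] at this
    omega

/-- **A stage of genus `g` has a handle decomposition of type `(1, g)`**
(`HasHandleDecomposition n s.X (handleCount 1 g)`: one critical point of index `0`, `g` of
index `1`, none of higher index). [folklore] -/
theorem hasHandleDecomposition (s : OneHandlebodyStage.{u} n) :
    HasHandleDecomposition n s.X (handleCount 1 s.genus) := by
  refine ⟨s.f, s.adapted, fun k => ?_⟩
  rcases Nat.lt_or_ge k 2 with hk | hk
  · interval_cases k
    · rw [handleCount_zero, s.ncard_zero]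
    · rw [handleCount_one]; rfl
  · rw [handleCount_of_two_le _ _ hk, s.criticalSetOfIndex_eq_empty hk, ncard_empty]

/-- Critical points of a stage are interior points (the Morse function is regular on the
boundary). [folklore] -/
theorem isInteriorPoint_of_isMCriticalPt (s : OneHandlebodyStage.{u} n) {z : s.X}
    (hz : IsMCriticalPt (𝓡∂ (n + 1)) s.f z) : (𝓡∂ (n + 1)).IsInteriorPoint z :=
  ((𝓡∂ (n + 1)).isInteriorPoint_iff_not_isBoundaryPoint z).2 fun hb => (s.adapted.2.1 z hb).2 hz

/-- A stage has a critical point of index `0`, and only one. [folklore] -/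
theorem exists_criticalSetOfIndex_zero_eq (s : OneHandlebodyStage.{u} n) :
    ∃ p₀, criticalSetOfIndex (𝓡∂ (n + 1)) s.f 0 = {p₀} :=
  ncard_eq_one.1 s.ncard_zero

/-- **The index-`0` critical point is the bottom critical point**: its value is below the value
of every other critical point.  The minimum of `f` on the compact `X` is attained, at an
interior point (on the boundary `f = 1`, while `f < 1` at the interior point `p₀`), which is
therefore a critical point (`Literature.Topology.FourManifolds.isMCriticalPt_of_isLocalMin`) of
index `0` (`Literature.Topology.FourManifolds.morseIndex_eq_zero_of_isLocalMin_of_isInteriorPoint`),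
i.e. `p₀`; the inequality is strict by injectivity on the critical set.  Milnor (1963), §3.
[folklore] -/
theorem apply_lt_of_isMCriticalPt (s : OneHandlebodyStage.{u} n) {p₀ q : s.X}
    (hp₀ : criticalSetOfIndex (𝓡∂ (n + 1)) s.f 0 = {p₀}) (hq : IsMCriticalPt (𝓡∂ (n + 1)) s.f q)
    (hne : q ≠ p₀) : s.f p₀ < s.f q := by
  have hp₀mem : p₀ ∈ criticalSetOfIndex (𝓡∂ (n + 1)) s.f 0 := by rw [hp₀]; exact mem_singleton _
  haveI : Nonempty s.X := ⟨p₀⟩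
  have hcont : Continuous s.f := s.adapted.1.1.continuous
  obtain ⟨m, -, hm⟩ := isCompact_univ.exists_isMinOn univ_nonempty hcont.continuousOn
  have hp₀1 : s.f p₀ < 1 := s.adapted.2.2 p₀ (s.isInteriorPoint_of_isMCriticalPt hp₀mem.1)
  have hmi : (𝓡∂ (n + 1)).IsInteriorPoint m := by
    refine ((𝓡∂ (n + 1)).isInteriorPoint_iff_not_isBoundaryPoint m).2 fun hb => ?_
    have h1 := (s.adapted.2.1 m hb).1
    have h2 : s.f m ≤ s.f p₀ := hm (mem_univ p₀)
    linarith
  have hloc : IsLocalMin s.f m := hm.isLocalMin Filter.univ_mem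
  have hmc : IsMCriticalPt (𝓡∂ (n + 1)) s.f m := isMCriticalPt_of_isLocalMin hloc hmi
  have hm0 : morseIndex (𝓡∂ (n + 1)) s.f m = 0 :=
    morseIndex_eq_zero_of_isLocalMin_of_isInteriorPoint (s.adapted.isMorse.contMDiffAt_two m)
      hloc hmi
  have hm_eq : m = p₀ := by
    have : m ∈ criticalSetOfIndex (𝓡∂ (n + 1)) s.f 0 := ⟨hmc, hm0⟩
    rw [hp₀] at this
    exact this
  subst hm_eq
  exact lt_of_le_of_ne (hm (mem_univ q)) fun h => hne (s.injOn_criticalSet hq hp₀mem.1 h.symm)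

/-- **The boundary of a stage is connected and nonempty** in dimension `n + 1 ≥ 3`: all
critical points have index `≤ 1`, i.e. coindex `≥ n ≥ 2`
(`IsMorseAdapted.isPreconnected_boundary_and_nonempty`, `LickorishWallaceProofs.lean`; Kosinski
(1993), VI (11.5): "if `λ ≤ m - 2` then `∂W` is connected"). [cite: Kosinski1993, VI (11.5)] -/
theorem isConnected_boundary (s : OneHandlebodyStage.{u} n) (hn : 2 ≤ n) :
    IsConnected ((𝓡∂ (n + 1)).boundary s.X) := by
  letI := s.cs; letI := s.mfd
  haveI : NeZero n := ⟨by omega⟩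
  haveI : LocallyPathConnectedSpace s.X :=
    ChartedSpace.locallyPathConnectedSpace (EuclideanHalfSpace (n + 1)) s.X
  have hidx : ∀ x, (𝓡∂ (n + 1)).IsInteriorPoint x → IsMCriticalPt (𝓡∂ (n + 1)) s.f x →
      morseIndex (𝓡∂ (n + 1)) s.f x + 2 ≤ n + 1 := fun x _ hx => by
    have := s.morseIndex_le_one x hx
    omega
  obtain ⟨hpre, hne⟩ := s.adapted.isPreconnected_boundary_and_nonempty hidx
  exact ⟨hne, hpre⟩

/-- A stage of genus `0` has exactly one critical point, of index `0`. [folklore] -/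
theorem existsUnique_of_genus_eq_zero (s : OneHandlebodyStage.{u} n) (h : s.genus = 0) :
    (∃! z, IsMCriticalPt (𝓡∂ (n + 1)) s.f z) ∧
      ∀ z, IsMCriticalPt (𝓡∂ (n + 1)) s.f z → morseIndex (𝓡∂ (n + 1)) s.f z = 0 := by
  have h1 : criticalSetOfIndex (𝓡∂ (n + 1)) s.f 1 = ∅ :=
    (ncard_eq_zero (s.finite_criticalSetOfIndex 1)).1 h
  have hidx : ∀ z, IsMCriticalPt (𝓡∂ (n + 1)) s.f z → morseIndex (𝓡∂ (n + 1)) s.f z = 0 := by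
    intro z hz
    have hle := s.morseIndex_le_one z hz
    rcases Nat.lt_or_ge (morseIndex (𝓡∂ (n + 1)) s.f z) 1 with h0 | h0
    · omega
    · have : z ∈ criticalSetOfIndex (𝓡∂ (n + 1)) s.f 1 := ⟨hz, le_antisymm hle h0⟩
      rw [h1] at this
      exact this.elim
  obtain ⟨p₀, hp₀⟩ := s.exists_criticalSetOfIndex_zero_eq
  have hp₀mem : p₀ ∈ criticalSetOfIndex (𝓡∂ (n + 1)) s.f 0 := by rw [hp₀]; exact mem_singleton _
  refine ⟨⟨p₀, hp₀mem.1, fun z hz => ?_⟩, hidx⟩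
  have : z ∈ criticalSetOfIndex (𝓡∂ (n + 1)) s.f 0 := ⟨hz, hidx z hz⟩
  rw [hp₀] at this
  exact this

/-- **Cutting a stage below its top critical point** (`n + 1 ≥ 2`).  A stage `s` of genus
`j + 1` contains a stage `t` of genus `j` from which it is obtained by attaching one `1`-handle
(`Literature.Topology.FourManifolds.IsHandleAttachment n 1 t.X s.X`): let `p` be the critical
point with the largest value — of index `1`, the index-`0` point being the bottom one
(`apply_lt_of_isMCriticalPt`) — and `a` a regular level between the second largest critical
value and `f p`; then `t` is the sublevel set `f⁻¹(-∞, a]` with its manifold-with-boundary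
structure and the adapted Morse function `f + (1 - a)` (Milnor 1965, Lemma 2.9;
`Literature.Topology.FourManifolds.exists_isManifold_sublevel_of_le`), which keeps all critical
points but `p` with their indices, is compact, connected (one critical point of index `0`:
`IsMorseAdapted.isConnected_preimage_Iic`) and orientable (pull back along the inclusion, a
smooth embedding: `IsOrientable.of_isSmoothEmbedding`).  Milnor, *Lectures on the h-cobordism
theorem* (1965), proof of Cor. 2.10; Kosinski (1993), VII §§1–2.
[cite: MilnorHCobordism1965, Lemma 2.9 and Cor. 2.10] -/
theorem exists_cut (hn : 1 ≤ n) (s : OneHandlebodyStage.{u} n) {j : ℕ} (hj : s.genus = j + 1) :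
    ∃ t : OneHandlebodyStage.{u} n, t.genus = j ∧
      @IsHandleAttachment n 1 t.X s.X _ t.cs _ s.cs := by
  obtain ⟨p₀, hp₀⟩ := s.exists_criticalSetOfIndex_zero_eq
  have hp₀mem : p₀ ∈ criticalSetOfIndex (𝓡∂ (n + 1)) s.f 0 := by rw [hp₀]; exact mem_singleton _
  have hne : (criticalSet (𝓡∂ (n + 1)) s.f).Nonempty := ⟨p₀, hp₀mem.1⟩
  -- the top critical point `p`
  obtain ⟨p, hpC, hpmax⟩ :=
    (criticalSet (𝓡∂ (n + 1)) s.f).exists_max_image s.f s.finite_criticalSet hne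
  have hp1 : s.f p < 1 := s.adapted.2.2 p (s.isInteriorPoint_of_isMCriticalPt hpC)
  -- `p` has index `1`: there is a critical point of index `1`, above `p₀`
  have hq : (criticalSetOfIndex (𝓡∂ (n + 1)) s.f 1).Nonempty :=
    nonempty_of_ncard_ne_zero
      (by rw [show (criticalSetOfIndex (𝓡∂ (n + 1)) s.f 1).ncard = j + 1 from hj]; omega)
  obtain ⟨q, hq⟩ := hq
  have hqp₀ : q ≠ p₀ := fun h => by
    have h0 := hp₀mem.2; have h1 := hq.2; rw [h] at h1; rw [h1] at h0; exact one_ne_zero h0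
  have hpp₀ : p ≠ p₀ := fun h => by
    have hlt := s.apply_lt_of_isMCriticalPt hp₀ hq.1 hqp₀
    have hle := hpmax q hq.1
    rw [h] at hle
    exact absurd (hlt.trans_le hle) (lt_irrefl _)
  have hpidx : morseIndex (𝓡∂ (n + 1)) s.f p = 1 := by
    have hle := s.morseIndex_le_one p hpC
    rcases Nat.lt_or_ge (morseIndex (𝓡∂ (n + 1)) s.f p) 1 with h0 | h0
    · exfalso
      have : p ∈ criticalSetOfIndex (𝓡∂ (n + 1)) s.f 0 := ⟨hpC, by omega⟩
      rw [hp₀] at this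
      exact hpp₀ this
    · exact le_antisymm hle h0
  -- the level `a`
  obtain ⟨b, hbB, hbmax⟩ :=
    (insert (s.f p - 1) (s.f '' (criticalSet (𝓡∂ (n + 1)) s.f \ {p}))).exists_max_image id
      (((s.finite_criticalSet.sdiff).image _).insert _) ⟨_, mem_insert _ _⟩
  have hb : b < s.f p := by
    rcases hbB with rfl | ⟨q', ⟨hqC, hqp⟩, rfl⟩
    · linarith
    · exact lt_of_le_of_ne (hpmax q' hqC) fun heq => hqp (s.injOn_criticalSet hqC hpC heq)
  have hle : ∀ q' ∈ criticalSet (𝓡∂ (n + 1)) s.f, q' ≠ p → s.f q' ≤ b := fun q' hq' hqp =>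
    hbmax (s.f q') (mem_insert_of_mem _ ⟨q', ⟨hq', hqp⟩, rfl⟩)
  set a : ℝ := (b + s.f p) / 2 with ha
  have hab : b < a := by rw [ha]; linarith
  have hap : a < s.f p := by rw [ha]; linarith
  have ha1 : a < 1 := hap.trans hp1
  have huniq : ∀ z, IsMCriticalPt (𝓡∂ (n + 1)) s.f z → a < s.f z → z = p := by
    intro z hz hza
    by_contra hzp
    exact absurd (hle z hz hzp) (not_le.2 (hab.trans hza))
  have hreg : ∀ z, IsMCriticalPt (𝓡∂ (n + 1)) s.f z → s.f z ≠ a := by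
    intro z hz hza
    by_cases hzp : z = p
    · exact absurd hza (by rw [hzp]; exact hap.ne')
    · exact absurd (hle z hz hzp) (by rw [hza]; exact not_le.2 hab)
  -- the sublevel set as a manifold with boundary
  obtain ⟨cs', mfd', hemb, hg, hcrit, hidx⟩ :
      ∃ (_ : ChartedSpace (EuclideanHalfSpace (n + 1)) ↥(s.f ⁻¹' Iic a))
        (_ : IsManifold (𝓡∂ (n + 1)) ∞ ↥(s.f ⁻¹' Iic a)),
        Manifold.IsSmoothEmbedding (𝓡∂ (n + 1)) (𝓡∂ (n + 1)) ∞
            (Subtype.val : ↥(s.f ⁻¹' Iic a) → s.X) ∧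
          IsMorseAdapted (𝓡∂ (n + 1)) (fun x : ↥(s.f ⁻¹' Iic a) => s.f x + (1 - a)) ∧
          (∀ x : ↥(s.f ⁻¹' Iic a),
            IsMCriticalPt (𝓡∂ (n + 1)) (fun x : ↥(s.f ⁻¹' Iic a) => s.f x + (1 - a)) x ↔
              IsMCriticalPt (𝓡∂ (n + 1)) s.f x.1) ∧
          (∀ x : ↥(s.f ⁻¹' Iic a), IsMCriticalPt (𝓡∂ (n + 1)) s.f x.1 →
            morseIndex (𝓡∂ (n + 1)) (fun x : ↥(s.f ⁻¹' Iic a) => s.f x + (1 - a)) x =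
              morseIndex (𝓡∂ (n + 1)) s.f x.1) :=
    @exists_isManifold_sublevel_of_le n hn s.X _ s.cs s.mfd s.f a s.adapted ha1 hreg
  haveI : CompactSpace ↥(s.f ⁻¹' Iic a) := isCompact_iff_compactSpace.1
    ((isClosed_le s.adapted.1.1.continuous continuous_const).isCompact)
  set g : ↥(s.f ⁻¹' Iic a) → ℝ := fun x => s.f x + (1 - a) with hgdef
  -- critical points and indices of `g`
  have hcritS : criticalSet (𝓡∂ (n + 1)) g =
      Subtype.val ⁻¹' (criticalSet (𝓡∂ (n + 1)) s.f \ {p}) := by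
    ext x
    simp only [mem_criticalSet, mem_preimage, Set.mem_sdiff, mem_singleton_iff]
    rw [hcrit x]
    refine ⟨fun h => ⟨h, fun hx => ?_⟩, fun h => h.1⟩
    have : s.f p ≤ a := by simpa [hx] using x.2
    exact absurd this (not_le.2 hap)
  have hsub : criticalSet (𝓡∂ (n + 1)) s.f \ {p} ⊆
      range (Subtype.val : ↥(s.f ⁻¹' Iic a) → s.X) := by
    rintro q' ⟨hq', hqp⟩
    exact ⟨⟨q', show s.f q' ≤ a from (hle q' hq' hqp).trans hab.le⟩, rfl⟩
  have hcritK : ∀ k, criticalSetOfIndex (𝓡∂ (n + 1)) g k =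
      Subtype.val ⁻¹' (criticalSetOfIndex (𝓡∂ (n + 1)) s.f k \ {p}) := by
    intro k
    ext x
    simp only [mem_criticalSetOfIndex, mem_preimage, Set.mem_sdiff, mem_singleton_iff]
    constructor
    · rintro ⟨hx, hxk⟩
      have hx' : x ∈ criticalSet (𝓡∂ (n + 1)) g := hx
      rw [hcritS] at hx'
      exact ⟨⟨hx'.1, by rw [← hidx x hx'.1]; exact hxk⟩, hx'.2⟩
    · rintro ⟨⟨hx, hxk⟩, hxp⟩
      exact ⟨(hcrit x).2 hx, by rw [hidx x hx]; exact hxk⟩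
  have hsubK : ∀ k, criticalSetOfIndex (𝓡∂ (n + 1)) s.f k \ {p} ⊆
      range (Subtype.val : ↥(s.f ⁻¹' Iic a) → s.X) := fun k =>
    (sdiff_subset_sdiff_left (criticalSetOfIndex_subset _ _ _)).trans hsub
  -- index `0` below: exactly `p₀`
  have h0 : criticalSetOfIndex (𝓡∂ (n + 1)) g 0 = Subtype.val ⁻¹' {p₀} := by
    rw [hcritK 0, hp₀]
    congr 1
    ext z
    simp only [Set.mem_sdiff, mem_singleton_iff]
    exact ⟨fun h => h.1, fun h => ⟨h, fun h' => hpp₀ (h'.symm.trans h)⟩⟩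
  have hp₀a : s.f p₀ ≤ a := (hle p₀ hp₀mem.1 hpp₀.symm).trans hab.le
  have hncard0 : (criticalSetOfIndex (𝓡∂ (n + 1)) g 0).ncard = 1 := by
    rw [h0, ncard_preimage_of_injective_subset_range Subtype.val_injective
      (fun x hx => ⟨⟨p₀, hp₀a⟩, (mem_singleton_iff.1 hx).symm⟩), ncard_singleton]
  -- connectedness and orientability of the sublevel set
  have hconn : ConnectedSpace ↥(s.f ⁻¹' Iic a) := by
    have h0s : (criticalSetOfIndex (𝓡∂ (n + 1)) s.f 0).Subsingleton := by
      rw [hp₀]; exact subsingleton_singleton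
    exact isConnected_iff_connectedSpace.1
      (s.adapted.isConnected_preimage_Iic h0s ha1 ⟨p₀, hp₀a⟩)
  have horient : IsOrientable (𝓡∂ (n + 1)) ↥(s.f ⁻¹' Iic a) :=
    IsOrientable.of_isSmoothEmbedding hemb s.orientable
  -- the new stage
  let t : OneHandlebodyStage.{u} n :=
    { X := ↥(s.f ⁻¹' Iic a)
      conn := hconn
      orientable := horient
      f := g
      adapted := hg
      injOn_criticalSet := by
        intro x hx y hy hxy
        rw [hcritS] at hx hy
        have hxy' : s.f x.1 = s.f y.1 := by simpa [hgdef] using hxy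
        exact Subtype.val_injective (s.injOn_criticalSet hx.1 hy.1 hxy')
      ncard_zero := hncard0
      morseIndex_le_one := fun z hz => by
        have hz' : z ∈ criticalSet (𝓡∂ (n + 1)) g := hz
        rw [hcritS] at hz'
        rw [hidx z hz'.1]
        exact s.morseIndex_le_one z.1 hz'.1 }
  refine ⟨t, ?_, Subtype.val, s.f, a, hemb, s.adapted, ha1, hreg, Subtype.range_val, ?_, ?_⟩
  · -- genus drops by one
    show (criticalSetOfIndex (𝓡∂ (n + 1)) g 1).ncard = j
    have hpmem : p ∈ criticalSetOfIndex (𝓡∂ (n + 1)) s.f 1 := ⟨hpC, hpidx⟩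
    have h := ncard_sdiff_singleton_add_one hpmem (s.finite_criticalSetOfIndex 1)
    rw [hcritK 1, ncard_preimage_of_injective_subset_range Subtype.val_injective (hsubK 1)]
    rw [show (criticalSetOfIndex (𝓡∂ (n + 1)) s.f 1).ncard = j + 1 from hj] at h
    omega
  · exact ⟨p, ⟨hpC, hap⟩, fun z hz => huniq z hz.1 hz.2⟩
  · intro z hz hza
    rw [huniq z hz hza, hpidx]

/-- **Stages of the same genus are diffeomorphic, granted L0 and L1** (dimension `n + 1 ≥ 3`;
induction on the genus, Kosinski's proof of VI (11.4)(c) one handle at a time): in genus `0`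
both are `0`-handles, i.e. closed `(n+1)`-balls (L0); in genus `j + 1` cut both below their
top critical points (`exists_cut`), apply the induction hypothesis to the genus-`j` stages and
L1 to the two `1`-handle attachments (boundaries connected by `isConnected_boundary`,
everything orientable). [cite: Kosinski1993, VI (11.4)(c)] -/
theorem nonempty_diffeomorph (hn : 2 ≤ n) (h₀ : zeroHandle_nonempty_diffeomorph_closedBall.{u})
    (h₁ : oneHandle_nonempty_diffeomorph.{u}) :
    ∀ (j : ℕ) (s t : OneHandlebodyStage.{u} n), s.genus = j → t.genus = j →
      Nonempty (s.X ≃ₘ⟮𝓡∂ (n + 1), 𝓡∂ (n + 1)⟯ t.X) := by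
  intro j
  induction j with
  | zero =>
    intro s t hs ht
    letI := s.cs; letI := s.mfd; letI := t.cs; letI := t.mfd
    obtain ⟨hsu, hsi⟩ := s.existsUnique_of_genus_eq_zero hs
    obtain ⟨htu, hti⟩ := t.existsUnique_of_genus_eq_zero ht
    obtain ⟨es⟩ := h₀ n s.X s.f s.adapted hsu hsi
    obtain ⟨et⟩ := h₀ n t.X t.f t.adapted htu hti
    exact ⟨es.trans et.symm⟩
  | succ j ih =>
    intro s t hs ht
    have hn1 : 1 ≤ n := by omega
    obtain ⟨s', hs', hatt⟩ := s.exists_cut hn1 hs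
    obtain ⟨t', ht', hatt'⟩ := t.exists_cut hn1 ht
    obtain ⟨e⟩ := ih s' t' hs' ht'
    letI := s.cs; letI := s.mfd; letI := t.cs; letI := t.mfd
    letI := s'.cs; letI := s'.mfd; letI := t'.cs; letI := t'.mfd
    exact h₁ n hn s'.X t'.X s.X t.X hatt hatt' (s'.isConnected_boundary hn) s.orientable
      t.orientable e

end OneHandlebodyStage

/-- **A compact connected orientable manifold with a handle decomposition of type `(1, k)`
carries a stage of genus `k`** (Milnor 1965, Lemma 2.8: separate the critical values without
changing critical points or indices,
`Literature.Topology.FourManifolds.exists_isMorseAdapted_injOn_criticalSet`).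
[cite: MilnorHCobordism1965, Lemma 2.8] -/
theorem exists_oneHandlebodyStage_of_hasHandleDecomposition {n k : ℕ} {V : Type u}
    [TopologicalSpace V] [T2Space V] [SecondCountableTopology V] [CompactSpace V]
    [ConnectedSpace V] [ChartedSpace (EuclideanHalfSpace (n + 1)) V]
    [IsManifold (𝓡∂ (n + 1)) ∞ V]
    (hV : HasHandleDecomposition n V (handleCount 1 k)) (ho : IsOrientable (𝓡∂ (n + 1)) V) :
    ∃ s : OneHandlebodyStage.{u} n, s.genus = k ∧
      Nonempty (s.X ≃ₘ⟮𝓡∂ (n + 1), 𝓡∂ (n + 1)⟯ V) := by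
  obtain ⟨f₀, hf₀, hcount⟩ := hV
  obtain ⟨f, hf, hcrit, hidx, hinj⟩ : ∃ f : V → ℝ, IsMorseAdapted (𝓡∂ (n + 1)) f ∧
      criticalSet (𝓡∂ (n + 1)) f = criticalSet (𝓡∂ (n + 1)) f₀ ∧
      (∀ q ∈ criticalSet (𝓡∂ (n + 1)) f₀,
        morseIndex (𝓡∂ (n + 1)) f q = morseIndex (𝓡∂ (n + 1)) f₀ q) ∧
      InjOn f (criticalSet (𝓡∂ (n + 1)) f) :=
    exists_isMorseAdapted_injOn_criticalSet n V f₀ hf₀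
  have hfin₀ : (criticalSet (𝓡∂ (n + 1)) f₀).Finite := IsMorse.finite_criticalSet_holds hf₀.isMorse
  have hK : ∀ k, criticalSetOfIndex (𝓡∂ (n + 1)) f k = criticalSetOfIndex (𝓡∂ (n + 1)) f₀ k := by
    intro k
    ext z
    simp only [mem_criticalSetOfIndex]
    constructor
    · rintro ⟨hz, hzk⟩
      have hz₀ : z ∈ criticalSet (𝓡∂ (n + 1)) f₀ := by rw [← hcrit]; exact hz
      exact ⟨hz₀, by rw [← hidx z hz₀]; exact hzk⟩
    · rintro ⟨hz, hzk⟩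
      have hz' : z ∈ criticalSet (𝓡∂ (n + 1)) f := by rw [hcrit]; exact hz
      exact ⟨hz', by rw [hidx z hz]; exact hzk⟩
  refine ⟨⟨V, ho, f, hf, hinj, ?_, ?_⟩, ?_, ⟨Diffeomorph.refl _ _ _⟩⟩
  · rw [hK 0, hcount 0, handleCount_zero]
  · intro z hz
    have hz₀ : z ∈ criticalSet (𝓡∂ (n + 1)) f₀ := by rw [← hcrit]; exact hz
    rw [hidx z hz₀]
    by_contra hk
    have hk2 : 2 ≤ morseIndex (𝓡∂ (n + 1)) f₀ z := by omega
    have hmem : z ∈ criticalSetOfIndex (𝓡∂ (n + 1)) f₀ (morseIndex (𝓡∂ (n + 1)) f₀ z) :=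
      ⟨hz₀, rfl⟩
    have hfin' : (criticalSetOfIndex (𝓡∂ (n + 1)) f₀ (morseIndex (𝓡∂ (n + 1)) f₀ z)).Finite :=
      hfin₀.subset (criticalSetOfIndex_subset _ _ _)
    have h0 : (criticalSetOfIndex (𝓡∂ (n + 1)) f₀ (morseIndex (𝓡∂ (n + 1)) f₀ z)).ncard = 0 := by
      rw [hcount, handleCount_of_two_le _ _ hk2]
    rw [Set.ncard_eq_zero hfin'] at h0
    rw [h0] at hmem
    exact hmem
  · show (criticalSetOfIndex (𝓡∂ (n + 1)) f 1).ncard = k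
    rw [hK 1, hcount 1, handleCount_one]

/-! ### The classification from the handle facts -/

/-- **Classification of orientable `1`-handlebodies of dimension `n + 1 ≥ 3` from L0 and L1**
(Kosinski, *Differential Manifolds* (1993), VI (11.4)(c): "Genus and orientability form a
complete set of diffeomorphism invariants" of `(m, 1)`-handlebodies, `m > 2`).  Compact
connected orientable smooth `(n+1)`-manifolds with boundary `V`, `V₀` (`n ≥ 2`) with handle
decompositions of type `(1, k)` for the same `k` are diffeomorphic, granted that a `0`-handle
is a disc (`zeroHandle_nonempty_diffeomorph_closedBall`) and that attaching one `1`-handle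
orientably to a connected boundary is unique (`oneHandle_nonempty_diffeomorph`): present both
by stages (`exists_oneHandlebodyStage_of_hasHandleDecomposition`) and compare the stages
(`OneHandlebodyStage.nonempty_diffeomorph`). [cite: Kosinski1993, VI (11.4)(c)] -/
theorem nonempty_diffeomorph_of_hasHandleDecomposition_handleCount_one_of_handles'
    (h₀ : zeroHandle_nonempty_diffeomorph_closedBall.{u}) (h₁ : oneHandle_nonempty_diffeomorph.{u})
    {n : ℕ} (hn : 2 ≤ n) (k : ℕ)
    (V : Type u) [TopologicalSpace V] [T2Space V] [SecondCountableTopology V] [CompactSpace V]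
    [ConnectedSpace V] [ChartedSpace (EuclideanHalfSpace (n + 1)) V] [IsManifold (𝓡∂ (n + 1)) ∞ V]
    (V₀ : Type u) [TopologicalSpace V₀] [T2Space V₀] [SecondCountableTopology V₀]
    [CompactSpace V₀] [ConnectedSpace V₀] [ChartedSpace (EuclideanHalfSpace (n + 1)) V₀]
    [IsManifold (𝓡∂ (n + 1)) ∞ V₀]
    (hV : HasHandleDecomposition n V (handleCount 1 k)) (ho : IsOrientable (𝓡∂ (n + 1)) V)
    (hV₀ : HasHandleDecomposition n V₀ (handleCount 1 k)) (ho₀ : IsOrientable (𝓡∂ (n + 1)) V₀) :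
    Nonempty (V ≃ₘ⟮𝓡∂ (n + 1), 𝓡∂ (n + 1)⟯ V₀) := by
  obtain ⟨s, hs, ⟨es⟩⟩ := exists_oneHandlebodyStage_of_hasHandleDecomposition hV ho
  obtain ⟨t, ht, ⟨et⟩⟩ := exists_oneHandlebodyStage_of_hasHandleDecomposition hV₀ ho₀
  obtain ⟨e⟩ := OneHandlebodyStage.nonempty_diffeomorph hn h₀ h₁ k s t hs ht
  exact ⟨es.symm.trans (e.trans et)⟩

/-- **UNIQ₄ from L0 and L1**: the classification of compact connected orientable
`4`-dimensional `1`-handlebodies with one `0`-handle and `k` `1`-handles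
(`Literature.Topology.FourManifolds.nonempty_diffeomorph_of_hasHandleDecomposition_handleCount_one`,
Kosinski (1993), VI (11.4)(c) with `m = 4`; Juhász (2023), §6.1: "the boundary connected sum of
a number of copies of `S¹ × D³`"), granted that a `0`-handle is a disc and that attaching one
`1`-handle orientably to a connected boundary is unique — the instance `n = 3` of
`nonempty_diffeomorph_of_hasHandleDecomposition_handleCount_one_of_handles'`.
[cite: Kosinski1993, VI (11.4)(c)] [cite: Juhasz2023, §6.1] -/
theorem nonempty_diffeomorph_of_hasHandleDecomposition_handleCount_one_of_handles
    (h₀ : zeroHandle_nonempty_diffeomorph_closedBall.{u}) (h₁ : oneHandle_nonempty_diffeomorph.{u}) :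
    nonempty_diffeomorph_of_hasHandleDecomposition_handleCount_one.{u} :=
  fun k V _ _ _ _ _ _ _ V₀ _ _ _ _ _ _ _ hV ho hV₀ ho₀ =>
    nonempty_diffeomorph_of_hasHandleDecomposition_handleCount_one_of_handles' h₀ h₁
      (n := 3) (by norm_num) k V V₀ hV ho hV₀ ho₀

/-- **The Laudenbach–Poénaru fact from NORM, L0, L1 and the two model facts.**
`Literature.Topology.FourManifolds.exists_diffeomorph_comp_incl_eq` (every self-diffeomorphism
of `∂V` extends over the compact connected orientable `4`-dimensional `1`-handlebody `V`;
Laudenbach–Poénaru (1972), Théorème A in its extension form) follows from the normal form NORM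
(`exists_hasHandleDecomposition_handleCount_one`), the two handle facts L0, L1 (which give
UNIQ₄, `nonempty_diffeomorph_of_hasHandleDecomposition_handleCount_one_of_handles`) and the
model facts LEMMA2ᴹ (`exists_oneHandlebody_laudenbachPoenaru_exists_diffeoExtends_mapOfEq_eq`)
and THMAᴹ (`exists_oneHandlebody_laudenbachPoenaru_diffeoExtends_of_isOrientationPreserving`),
by `exists_diffeomorph_comp_incl_eq_of_model'` (`SPC4HandlesSymmHolds.lean`, the symmetry SYMMᴹ
being discharged there). [cite: LaudenbachPoenaruBSMF1972, §2, Lemma 2 and proof of Thm. A]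
[cite: Kosinski1993, VI (11.4)(c)] -/
theorem exists_diffeomorph_comp_incl_eq_of_handles
    (hN : exists_hasHandleDecomposition_handleCount_one.{u})
    (h₀ : zeroHandle_nonempty_diffeomorph_closedBall.{u}) (h₁ : oneHandle_nonempty_diffeomorph.{u})
    (hL : exists_oneHandlebody_laudenbachPoenaru_exists_diffeoExtends_mapOfEq_eq.{u})
    (hA : exists_oneHandlebody_laudenbachPoenaru_diffeoExtends_of_isOrientationPreserving.{u}) :
    exists_diffeomorph_comp_incl_eq.{u} :=
  exists_diffeomorph_comp_incl_eq_of_model' hN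
    (nonempty_diffeomorph_of_hasHandleDecomposition_handleCount_one_of_handles h₀ h₁) hL hA

end Literature.Topology.FourManifolds
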